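import Summits.HodgeConjecture.HodgeConjecture.Theorems.H413OmegaAtLineGramCoinv
import Summits.HodgeConjecture.HodgeConjecture.Theorems.H413OmegaAtLineAdelicTwist
import HarnessLib

/-!
# FLOOR-0 P4, seat S4′(i) ∕ S4b, step (1c) ADELIC — the pin-spelled `ω` at the line IS a twist of the model's coinvariants, the twist being the finite part
# of a rationally trivial continuous ADELIC pair character `ĉ` with `chiSplitting θ = splittingOf h ⊗ ĉ`

Cell hodgecm-mathlib (D-0151), FLOOR 0, crux item H413 = stmt-HodgeConjecture-24833; P4 line (ed. 2), stub S4b.  Author F0P4-p01 (g0) (seat (i)); SEAT-i MEMO v4.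
`--supports stmt-HodgeConjecture-24833 --as helper`.  DEF-FREE.  HC_CM is proved only modulo the printed citations until rung 0 closes.

**`exists_coinv_equiv_TW_splittingOf_adelic`** = ★ p795555 `exists_coinv_equiv_TW_lineVec` ∘ ★ `exists_coinv_equiv_chiSplitting_splittingOf_adelic`
(`H413OmegaAtLineAdelicTwist`): the statement of ★ p796716 `exists_coinv_equiv_TW_splittingOf` with the finite twist `χtw` REPLACED by `ĉ ∘ ι_pair ∘ finPairToAdelic`
for an adelic pair character `ĉ` carrying: the twist equation `chiSplitting θ (lineVec ↑a) = splittingOf h ⊗ ĉ` (for the archimedean desk: it identifies the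
model's archimedean Weil representation twisted by `ν⁻¹ = ĉ_V · χ₀(·,1)⁻¹` with the `μ`-normalised one), rational triviality of `ĉ ∘ ι_V` and `ĉ ∘ ι_W`, and
continuity — exactly the inputs `hκ`, `hκc` of ★ `exists_knob` (`κ := ĉ ∘ ι_V`), whose `ν` then satisfies `hknob` of ★ `exists_holTheta_atLine_of_inputs` with
`λ g := (ĉ ∘ ι_pair ∘ fin) (ιVE V g, 1) = ĉ (ι_V (ιVE V g)_𝔸)` (`comp_pairEmbFin_apply_inl`).

## References
* [GelbartRogawski1991] S. Gelbart, J. Rogawski, Invent. Math. 105 (1991), §3.1 Prop. 3.1.1 p. 455; Remark p. 457 L4–13.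
* [Liu2021] Y. Liu, Camb. J. Math. 9 (2021), Def. 4.11; App. D §D.1 Steps 1–3 (l. 5217–5221).
-/

set_option autoImplicit false
set_option linter.dupNamespace false

noncomputable section

open scoped Matrix Kronecker
open NumberField IsDedekindDomain
open Literature.NumberTheory.Automorphic Literature.NumberTheory.Automorphic.UnitaryGroup
open Literature.NumberTheory.Weil1964
open Literature.NumberTheory.GelbartRogawski1991 Literature.NumberTheory.GelbartRogawski1991.UnitaryDualPair
open Literature.NumberTheory.GelbartRogawski1991.UnitaryDualPair.WeilCoinv
open Literature.NumberTheory.Automorphic.Liu2021.Def411WeilCarriersDoubling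
open Literature.NumberTheory.Automorphic.Liu2021.Def411WeilCarriers (TW JW JW_eq isSymm_TW isUnit_det_TW)
open Literature.NumberTheory.GelbartRogawski1991.GRConstruction (Fp)
open Literature.NumberTheory.GaloisRepresentations (HeckeCharacter)
open Literature.RepresentationTheory.HarrisKudlaSweet1996 (IsSplittingChar)

namespace Summit.HodgeConjecture.HodgeConjecture.Cruxes.H413.ThetaJunction

variable (L : Type) [Field L] [NumberField L] [IsCMField L] {N' n' : ℕ} (e₁ : Fin N' × Fin 1 ≃ Fin n')
  (dV₁ : Fin N' → L) (hdV₁ : ∀ i, IsCMField.complexConj L (dV₁ i) = dV₁ i) (hdV₁0 : ∀ i, dV₁ i ≠ 0)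
  (θ : HeckeCharacter L) (hθu : θ.IsUnitary) (hθs : IsSplittingChar L 1 θ)
  (a : (↥(maximalRealSubfield L))ˣ)
  (hW : (TW (↥(maximalRealSubfield L)) a).IsSymm) (hWd : IsUnit (TW (↥(maximalRealSubfield L)) a).det)
  (hJW : JW (↥(maximalRealSubfield L)) L a = (TW (↥(maximalRealSubfield L)) a).map (algebraMap (↥(maximalRealSubfield L)) L))
  (χW : UnitaryGroup.finAdelic (↥(maximalRealSubfield L)) L (IsCMField.complexConj L) 1 (JW (↥(maximalRealSubfield L)) L a) →* ℂˣ)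
  (h : (splittingDatum (Fp L) L (IsCMField.complexConj L) N' 1 e₁ (Matrix.diagonal dV₁)
      (Matrix.diagonal (lineVec L ((a : ↥(maximalRealSubfield L)) : L))) (complexConj_imagUnit L)
      (imagUnit_ne_zero L) (imagUnit_mul_self L) (realDiagonal_isSymm L dV₁ hdV₁) (realDiagonal_isSymm L _ (complexConj_lineVec_coe L a))
      (isUnit_det_realDiagonal L dV₁ hdV₁ hdV₁0) (isUnit_det_realDiagonal L _ (complexConj_lineVec_coe L a) (lineVec_coe_ne_zero L a))
      (realDiagonal_map L dV₁ hdV₁).symm (realDiagonal_map L _ (complexConj_lineVec_coe L a)).symm).CompatibleSplitting)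

set_option maxHeartbeats 4000000 in
/-- **step (1c), adelic form**: see the module docstring. [cite: GelbartRogawski1991, §3.1 Prop. 3.1.1 p. 455; Remark p. 457 L4–13] [cite: Liu2021, App. D §D.1 Steps 1–3] -/
theorem exists_coinv_equiv_TW_splittingOf_adelic :
    ∃ ĉ : UnitaryGroup.adelicPair (Fp L) L (IsCMField.complexConj L) N' 1 (Matrix.diagonal dV₁)
        (Matrix.diagonal (lineVec L ((a : ↥(maximalRealSubfield L)) : L))) →* ℂˣ,
      chiSplitting L e₁ dV₁ hdV₁ hdV₁0 (lineVec L ((a : ↥(maximalRealSubfield L)) : L)) (complexConj_lineVec_coe L a) (lineVec_coe_ne_zero L a)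
            θ hθu hθs =
          adelicMpCont.twist (Fp L) (Fin n') _ (splittingOf _ _ _ _ _ _ _ _ _ _ _ _ _ _ _ _ _ h) ĉ ∧
      (∀ γU ∈ (UnitaryGroup.toAdelic (Fp L) L (IsCMField.complexConj L) N' (Matrix.diagonal dV₁)).range,
          ĉ (UnitaryGroup.adelicInl (Fp L) L (IsCMField.complexConj L) N' 1 (Matrix.diagonal dV₁)
            (Matrix.diagonal (lineVec L ((a : ↥(maximalRealSubfield L)) : L))) γU) = 1) ∧
      (∀ γ ∈ (UnitaryGroup.toAdelic (Fp L) L (IsCMField.complexConj L) 1 (Matrix.diagonal (lineVec L ((a : ↥(maximalRealSubfield L)) : L)))).range,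
          ĉ (UnitaryGroup.adelicInr (Fp L) L (IsCMField.complexConj L) N' 1 (Matrix.diagonal dV₁)
            (Matrix.diagonal (lineVec L ((a : ↥(maximalRealSubfield L)) : L))) γ) = 1) ∧
      Continuous ĉ ∧
      ∃ Ψ : Literature.RepresentationTheory.TwistedCoinv.Coinv
            (finPairRepW (↥(maximalRealSubfield L)) L (IsCMField.complexConj L) N' 1 e₁ (Matrix.diagonal dV₁) (JW (↥(maximalRealSubfield L)) L a)
              (complexConj_imagUnit L) (imagUnit_ne_zero L) (imagUnit_mul_self L) (realDiagonal_isSymm L dV₁ hdV₁) hW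
              (isUnit_det_realDiagonal L dV₁ hdV₁ hdV₁0) hWd (realDiagonal_map L dV₁ hdV₁).symm hJW
              (isCompatible_chiSplittingLine L e₁ dV₁ hdV₁ hdV₁0 θ hθu hθs (TW (↥(maximalRealSubfield L)) a) hW hWd
                (JW (↥(maximalRealSubfield L)) L a) hJW))
            χW ≃ₗ[ℂ]
          Literature.RepresentationTheory.TwistedCoinv.Coinv
            ((finPairRep (Fp L) L (IsCMField.complexConj L) N' 1 e₁ (Matrix.diagonal dV₁) (Matrix.diagonal (lineVec L ((a : ↥(maximalRealSubfield L)) : L))) (complexConj_imagUnit L)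
              (imagUnit_ne_zero L) (imagUnit_mul_self L) (realDiagonal_isSymm L dV₁ hdV₁) (realDiagonal_isSymm L _ (complexConj_lineVec_coe L a))
              (isUnit_det_realDiagonal L dV₁ hdV₁ hdV₁0) (isUnit_det_realDiagonal L _ (complexConj_lineVec_coe L a) (lineVec_coe_ne_zero L a)) (realDiagonal_map L dV₁ hdV₁).symm
              (realDiagonal_map L _ (complexConj_lineVec_coe L a)).symm
              (splittingOf_isCompatible _ _ _ _ _ _ _ _ _ _ _ _ _ _ _ _ _ h)).comp (MonoidHom.inr _ _))
            (((ĉ.comp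
          ((MonoidHom.noncommCoprod
                (UnitaryGroup.adelicInl (Fp L) L (IsCMField.complexConj L) N' 1 (Matrix.diagonal dV₁)
                  (Matrix.diagonal (lineVec L ((a : ↥(maximalRealSubfield L)) : L))))
                (UnitaryGroup.adelicInr (Fp L) L (IsCMField.complexConj L) N' 1 (Matrix.diagonal dV₁)
                  (Matrix.diagonal (lineVec L ((a : ↥(maximalRealSubfield L)) : L))))
                (UnitaryGroup.commute_adelicInl_adelicInr (Fp L) L (IsCMField.complexConj L) N' 1 (Matrix.diagonal dV₁)
                  (Matrix.diagonal (lineVec L ((a : ↥(maximalRealSubfield L)) : L))))).comp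
            (finPairToAdelic (Fp L) L (IsCMField.complexConj L) N' 1 (Matrix.diagonal dV₁)
              (Matrix.diagonal (lineVec L ((a : ↥(maximalRealSubfield L)) : L)))))).comp (MonoidHom.inr _ _))⁻¹ * (χW.comp (MulEquiv.subgroupCongr (finAdelic_JW_eq L a)).symm.toMonoidHom)),
        (∀ f, Ψ (Literature.RepresentationTheory.TwistedCoinv.mk _ χW f) = Literature.RepresentationTheory.TwistedCoinv.mk _ _ f) ∧
        ∀ (k : UnitaryGroup.finAdelic (Fp L) L (IsCMField.complexConj L) N' (Matrix.diagonal dV₁)) (x : Literature.RepresentationTheory.TwistedCoinv.Coinv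
            (finPairRepW (↥(maximalRealSubfield L)) L (IsCMField.complexConj L) N' 1 e₁ (Matrix.diagonal dV₁) (JW (↥(maximalRealSubfield L)) L a)
              (complexConj_imagUnit L) (imagUnit_ne_zero L) (imagUnit_mul_self L) (realDiagonal_isSymm L dV₁ hdV₁) hW
              (isUnit_det_realDiagonal L dV₁ hdV₁ hdV₁0) hWd (realDiagonal_map L dV₁ hdV₁).symm hJW
              (isCompatible_chiSplittingLine L e₁ dV₁ hdV₁ hdV₁0 θ hθu hθs (TW (↥(maximalRealSubfield L)) a) hW hWd
                (JW (↥(maximalRealSubfield L)) L a) hJW))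
            χW),
          Ψ (weilCoinv (↥(maximalRealSubfield L)) L (IsCMField.complexConj L) N' 1 e₁ (Matrix.diagonal dV₁) (JW (↥(maximalRealSubfield L)) L a)
                (complexConj_imagUnit L) (imagUnit_ne_zero L) (imagUnit_mul_self L) (realDiagonal_isSymm L dV₁ hdV₁) hW
                (isUnit_det_realDiagonal L dV₁ hdV₁ hdV₁0) hWd (realDiagonal_map L dV₁ hdV₁).symm hJW χW
                (isCompatible_chiSplittingLine L e₁ dV₁ hdV₁ hdV₁0 θ hθu hθs (TW (↥(maximalRealSubfield L)) a) hW hWd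
                  (JW (↥(maximalRealSubfield L)) L a) hJW) k x) =
            (((ĉ.comp
          ((MonoidHom.noncommCoprod
                (UnitaryGroup.adelicInl (Fp L) L (IsCMField.complexConj L) N' 1 (Matrix.diagonal dV₁)
                  (Matrix.diagonal (lineVec L ((a : ↥(maximalRealSubfield L)) : L))))
                (UnitaryGroup.adelicInr (Fp L) L (IsCMField.complexConj L) N' 1 (Matrix.diagonal dV₁)
                  (Matrix.diagonal (lineVec L ((a : ↥(maximalRealSubfield L)) : L))))
                (UnitaryGroup.commute_adelicInl_adelicInr (Fp L) L (IsCMField.complexConj L) N' 1 (Matrix.diagonal dV₁)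
                  (Matrix.diagonal (lineVec L ((a : ↥(maximalRealSubfield L)) : L))))).comp
            (finPairToAdelic (Fp L) L (IsCMField.complexConj L) N' 1 (Matrix.diagonal dV₁)
              (Matrix.diagonal (lineVec L ((a : ↥(maximalRealSubfield L)) : L)))))) (k, 1) : ℂˣ) : ℂ) •
              Literature.RepresentationTheory.TwistedCoinv.rep (((ĉ.comp
          ((MonoidHom.noncommCoprod
                (UnitaryGroup.adelicInl (Fp L) L (IsCMField.complexConj L) N' 1 (Matrix.diagonal dV₁)
                  (Matrix.diagonal (lineVec L ((a : ↥(maximalRealSubfield L)) : L))))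
                (UnitaryGroup.adelicInr (Fp L) L (IsCMField.complexConj L) N' 1 (Matrix.diagonal dV₁)
                  (Matrix.diagonal (lineVec L ((a : ↥(maximalRealSubfield L)) : L))))
                (UnitaryGroup.commute_adelicInl_adelicInr (Fp L) L (IsCMField.complexConj L) N' 1 (Matrix.diagonal dV₁)
                  (Matrix.diagonal (lineVec L ((a : ↥(maximalRealSubfield L)) : L))))).comp
            (finPairToAdelic (Fp L) L (IsCMField.complexConj L) N' 1 (Matrix.diagonal dV₁)
              (Matrix.diagonal (lineVec L ((a : ↥(maximalRealSubfield L)) : L)))))).comp (MonoidHom.inr _ _))⁻¹ * (χW.comp (MulEquiv.subgroupCongr (finAdelic_JW_eq L a)).symm.toMonoidHom))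
                ((finPairRep (Fp L) L (IsCMField.complexConj L) N' 1 e₁ (Matrix.diagonal dV₁) (Matrix.diagonal (lineVec L ((a : ↥(maximalRealSubfield L)) : L))) (complexConj_imagUnit L)
                  (imagUnit_ne_zero L) (imagUnit_mul_self L) (realDiagonal_isSymm L dV₁ hdV₁) (realDiagonal_isSymm L _ (complexConj_lineVec_coe L a))
                  (isUnit_det_realDiagonal L dV₁ hdV₁ hdV₁0) (isUnit_det_realDiagonal L _ (complexConj_lineVec_coe L a) (lineVec_coe_ne_zero L a)) (realDiagonal_map L dV₁ hdV₁).symm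
                  (realDiagonal_map L _ (complexConj_lineVec_coe L a)).symm
                  (splittingOf_isCompatible _ _ _ _ _ _ _ _ _ _ _ _ _ _ _ _ _ h)).comp (MonoidHom.inl _ _))
                (commute_comp_inl_comp_inr _) k (Ψ x) := by
  obtain ⟨Ψ₁, hΨ₁mk, hΨ₁law⟩ := exists_coinv_equiv_TW_lineVec L e₁ dV₁ hdV₁ hdV₁0 θ hθu hθs a hW hWd hJW χW
  obtain ⟨ĉ, hĉ, hV, hW', hc, T, hTmk, hTlaw⟩ := exists_coinv_equiv_chiSplitting_splittingOf_adelic L e₁ dV₁ hdV₁ hdV₁0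
    (lineVec L ((a : ↥(maximalRealSubfield L)) : L)) (complexConj_lineVec_coe L a) (lineVec_coe_ne_zero L a) θ hθu hθs h
    (χW.comp (MulEquiv.subgroupCongr (finAdelic_JW_eq L a)).symm.toMonoidHom)
  refine ⟨ĉ, hĉ, hV, hW', hc, Ψ₁.trans T, fun f => ?_, fun k x => ?_⟩
  · rw [LinearEquiv.trans_apply, hΨ₁mk, hTmk]
  · rw [LinearEquiv.trans_apply, hΨ₁law, hTlaw, LinearEquiv.trans_apply]

end Summit.HodgeConjecture.HodgeConjecture.Cruxes.H413.ThetaJunction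

end
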